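import Summits.AtomisticToContinuum.HydrodynamicLimit.Theorems.OneFlightGossipEngineClampedCurrentsDockTransferTails
import Summits.AtomisticToContinuum.HydrodynamicLimit.Theorems.ImplosionDichotomyHydroLimitInBandWindowContinuityTransfer
import HarnessLib

/-!
# Momentum- and energy-activity tails from the TRANSFER-activity tails (line `IdeatorOneSketch`, crux `HydroLimitInBand`,
# stmt-AtomisticToContinuum-9133; support lemma for the five-input end state)

Support file (`--supports stmt-AtomisticToContinuum-9133`), registered stub `activityTails_of_transferActivityTails`:
the converse of the sibling's landed CC3 (`ClampedCurrentsDockTransferTails.stub_transferActivityTails : CAT → CEAT → TransferActivityTails`).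
The transfer activity of a particle over a window is its momentum activity plus its energy activity
(`ClampedCurrentsDockTransferTails.collisionSum_transfer_eq_add`, good data), both nonnegative, and the tail functional
`y ↦ 𝟙{V < y} y` is monotone on `[0, ∞)` at every level `V` (`indicator_tail_mono`); the good set has full local Gibbs measure, so the `lintegral` bounds of
`TransferActivityTails` dominate those of `CollisionActivityTails` (13734) and `CollisionEnergyActivityTails` with the same witnesses.
Hence ONE activity-tail input replaces the pair (CAT, CEAT) in the ledger's input list.
-/

noncomputable section

open MeasureTheory Filter Set Topology
open scoped ENNReal

namespace Summit.AtomisticToContinuum.HydrodynamicLimit.Theorems.HydroLimitInBandHeart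

open Literature.MathematicalPhysics.KineticTheory Literature.Analysis.FluidPDE Literature.Analysis.FunctionSpaces
open Summit.AtomisticToContinuum.HydrodynamicLimit.Theses
open Summit.AtomisticToContinuum.HydrodynamicLimit.Theorems

/-! ## §1 The tail functional is monotone on `[0, ∞)` -/

/-- The tail functional `y ↦ 𝟙{V < y} y` is monotone on `[0, ∞)`: for `0 ≤ y₁ ≤ y₂`,
`𝟙{V < y₁} y₁ ≤ 𝟙{V < y₂} y₂` (cases on `V < y₁`). [folklore] -/
theorem indicator_tail_mono {V y₁ y₂ : ℝ} (h₁ : 0 ≤ y₁) (h : y₁ ≤ y₂) :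
    Set.indicator {y : ℝ | V < y} (fun y => y) y₁ ≤ Set.indicator {y : ℝ | V < y} (fun y => y) y₂ := by
  by_cases hV : V < y₁
  · rw [indicator_of_mem (show y₁ ∈ {y : ℝ | V < y} from hV),
      indicator_of_mem (show y₂ ∈ {y : ℝ | V < y} from hV.trans_le h)]
    exact h
  · rw [indicator_of_notMem (show y₁ ∉ {y : ℝ | V < y} from hV)]
    exact Set.indicator_apply_nonneg fun _ => h₁.trans h

/-! ## §2 Activity tails below the transfer activity -/

/-- **Activity tails of a dominated summand.** If a nonnegative per-collision summand `S` has, particle by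
particle and on good data, window collision sums below those of the transfer summand
`‖v⁺ − v⁻‖ + |‖v⁺‖² − ‖v⁻‖²|/2`, then the `L¹` tail bounds of `TransferActivityTails` hold verbatim for the
`S`-activity, with the same witnesses `σ₀, V₀, τ₀, N₀`: pointwise on the good set (full local Gibbs measure)
`𝟙{V < a_i^S} a_i^S ≤ 𝟙{V < a_i} a_i` by `indicator_tail_mono`, then `Finset.sum_le_sum`,
`ENNReal.ofReal_le_ofReal` and `lintegral_mono_ae`. [folklore] -/
theorem activityTails_of_transfer_of_le (hT : ClampedCurrentsDockTransferTails.TransferActivityTails)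
    (S : (N : ℕ) → HardSphereCollisionRecord (Fin 3) T3 (N + 1) → ℝ) (hS : ∀ N c, 0 ≤ S N c)
    (hle : ∀ (σ : ℝ) (N : ℕ) (Φ : HardSphereFlow (Torus.geometry (Fin 3)) (hsDiameter σ N) (N + 1))
      (z : Config (N + 1) (Fin 3) T3), z ∈ Φ.good → ∀ (s s' : ℝ) (i : Fin (N + 1)),
      Φ.collisionSum (Set.Ioc s s') (fun c => if c.fst = i then S N c else 0) z ≤
        Φ.collisionSum (Set.Ioc s s')
          (fun c => if c.fst = i then ‖c.postVel.1 - c.preVel.1‖ + |‖c.postVel.1‖ ^ 2 - ‖c.preVel.1‖ ^ 2| / 2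
            else 0) z) :
    ∀ (a₀ θ₀ : T3 → ℝ) (u₀ : T3 → V3), Continuous a₀ → Continuous θ₀ → Continuous u₀ → (∀ x, 0 < a₀ x) →
    (∀ x, 0 < θ₀ x) → ∃ σ₀ : ℝ, 0 < σ₀ ∧ ∀ σ : ℝ, 0 < σ → σ < σ₀ →
    ∀ (T : ℝ) (ρ θ : ℝ → T3 → ℝ) (u : ℝ → T3 → V3), IsHardSphereEulerSolution σ T ρ u θ →
    ∀ Φ : (N : ℕ) → HardSphereFlow (Torus.geometry (Fin 3)) (hsDiameter σ N) (N + 1),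
    TendstoHydroFieldsAt (fun N => localGibbsLaw σ a₀ u₀ θ₀ N (Φ N)) Φ ρ u θ 0 →
    ∀ t ∈ Set.Ico 0 T, ∃ V₀ : ℝ, 0 < V₀ ∧ ∀ V : ℝ, V₀ ≤ V → ∀ ε : ℝ, 0 < ε → ∃ τ₀ : ℝ, 0 < τ₀ ∧
    ∀ τ : ℝ, τ₀ ≤ τ → ∃ N₀ : ℕ, ∀ N : ℕ, N₀ ≤ N → ∀ s ∈ Set.Icc 0 t,
      (let w : ℝ := τ * ((N : ℝ) + 1) ^ (-(1 / 3 : ℝ))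
       let P := localGibbsLaw σ a₀ u₀ θ₀ N (Φ N)
       let act := fun (i : Fin (N + 1)) (z : Config (N + 1) (Fin 3) T3) =>
         σ / τ * (Φ N).collisionSum (Set.Ioc s (s + w)) (fun c => if c.fst = i then S N c else 0) z
       ∫⁻ z, ENNReal.ofReal (((N : ℝ) + 1)⁻¹ * ∑ i : Fin (N + 1),
           Set.indicator {y : ℝ | V < y} (fun y => y) (act i z)) ∂P ≤ ENNReal.ofReal ε) := by
  intro a₀ θ₀ u₀ ha hθ hu ha0 hθ0
  obtain ⟨σ₀, hσ₀, H⟩ := hT a₀ θ₀ u₀ ha hθ hu ha0 hθ0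
  refine ⟨σ₀, hσ₀, fun σ hσ hσlt T ρ θ u hE Φ htie t ht => ?_⟩
  obtain ⟨V₀, hV₀, HV⟩ := H σ hσ hσlt T ρ θ u hE Φ htie t ht
  refine ⟨V₀, hV₀, fun V hV ε hε => ?_⟩
  obtain ⟨τ₀, hτ₀, Hτ⟩ := HV V hV ε hε
  refine ⟨τ₀, hτ₀, fun τ hτ => ?_⟩
  obtain ⟨N₀, HN⟩ := Hτ τ hτ
  refine ⟨N₀, fun N hN s hs => ?_⟩
  have h := HN N hN s hs
  dsimp only at h ⊢
  have hκ : 0 ≤ σ / τ := div_nonneg hσ.le (hτ₀.le.trans hτ)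
  -- the local Gibbs law gives full mass to the good set (it is Liouville-absolutely continuous)
  have hgood : ∀ᵐ z ∂(localGibbsLaw σ a₀ u₀ θ₀ N (Φ N)), z ∈ (Φ N).good := by
    rw [localGibbsLaw_eq]
    exact (localGibbsMeasure_absolutelyContinuous σ a₀ u₀ θ₀ N (Φ N)).ae_le (Φ N).ae_mem_good
  refine le_trans (lintegral_mono_ae ?_) h
  filter_upwards [hgood] with z hz
  refine ENNReal.ofReal_le_ofReal (mul_le_mul_of_nonneg_left (Finset.sum_le_sum fun i _ => ?_) (by positivity))
  refine indicator_tail_mono (mul_nonneg hκ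
    (HydroLimitInBandContinuity.collisionSum_nonneg' (Φ N) (fun c => ?_) _ z)) ?_
  · split_ifs
    · exact hS N c
    · exact le_rfl
  · exact mul_le_mul_of_nonneg_left (hle σ N (Φ N) z hz _ _ i) hκ

/-! ## §3 The stub -/

/-- **CAT and CEAT from the transfer-activity tails** (registered stub `activityTails_of_transferActivityTails` of
stmt-9133): on good data the transfer activity of a particle over a window is its momentum activity plus its
energy activity (`ClampedCurrentsDockTransferTails.collisionSum_transfer_eq_add`), both nonnegative
(`HydroLimitInBandContinuity.collisionSum_nonneg'`), so each is dominated by the transfer activity and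
`activityTails_of_transfer_of_le` applies twice. [folklore] -/
theorem activityTails_of_transferActivityTails :
    ClampedCurrentsDockTransferTails.TransferActivityTails →
      OneFlightGossipEngine.CollisionActivityTails ∧ ClampedCurrentsDockTransferTails.CollisionEnergyActivityTails := by
  intro hT
  constructor
  · exact activityTails_of_transfer_of_le hT (fun _ c => ‖c.postVel.1 - c.preVel.1‖) (fun _ _ => norm_nonneg _)
      fun σ N Φ z hz s s' i => by
        rw [ClampedCurrentsDockTransferTails.collisionSum_transfer_eq_add Φ hz s s' i]
        exact le_add_of_nonneg_right
          (HydroLimitInBandContinuity.collisionSum_nonneg' Φ (fun c => by positivity) _ z)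
  · exact activityTails_of_transfer_of_le hT (fun _ c => |‖c.postVel.1‖ ^ 2 - ‖c.preVel.1‖ ^ 2| / 2)
      (fun _ _ => by positivity) fun σ N Φ z hz s s' i => by
        rw [ClampedCurrentsDockTransferTails.collisionSum_transfer_eq_add Φ hz s s' i]
        exact le_add_of_nonneg_left
          (HydroLimitInBandContinuity.collisionSum_nonneg' Φ (fun c => by positivity) _ z)

end Summit.AtomisticToContinuum.HydrodynamicLimit.Theorems.HydroLimitInBandHeart

end
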